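import Summits.QuantumFields.YangMills.Theorems.BalabanUVNodesK0Stub3FinVolFace
import Summits.QuantumFields.YangMills.Theorems.BalabanUVNodesN22WindowSoftTwoPointAtRecord
import Summits.QuantumFields.YangMills.Theorems.BalabanUVNodesN22KernelLimitOfActivitySlots

/-!
# K0⁷ V19 — STUB 3ᴬ′, THE FINITE-VOLUME FACE (FILE 3): 3ᴬ′'s box FROM THE VALUE HALF OF N22's ACTIVITY-SLOT ENGINE + THE (1.21) EXISTENCE OF RECORD —
# no YoungLipschitz (differenced) slot, no NE9, no fading memory: the engine's value constant is HISTORY-UNIFORM before W1's per-sequence packaging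

Cell `pub-ymgap`, width seat `pub-ymgap-k0-s3-w2` (g2; director-ym R399 (3a) ∕ №207; bus CLAIM-2 ∕ INTENT-2 I.31258).  `--kind proof --supports stmt-QuantumFields-20541 --as helper`
(count-neutral).  NEW leaf; theorems only; 0 `def`; nothing modified; no registry write.  Imports CLAIM-1 FILE 2 `…K0Stub3FinVolFace` (the uniform box currency ⟹ 3ᴬ′ by name) and
dag-n22-w2's `…N22WindowSoftTwoPointAtRecord` (the soft-localized activity-slot engine at the record; nothing of it re-typed) and dag-n22-w3's `…N22KernelLimitOfActivitySlots`
((1.21) existence from the same slots + (S≈), by name).  [I] = [Balaban1987RG1]; [II] = [Balaban1988RG2Cluster];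
[15] = [Balaban1985Variational].

WHY.  The K0 box `|β₁₃(θ)| ≤ β′` on `]0, γ]^{k+1}` needs ONE constant for every history — a UNIFORM (5.10)-type bound.  W1's value letter `WindowedDecay(OfRecord₁₃)` is
per-SEQUENCE (`∀ g ∈ W, ∃ C₀`), and the K0 roads through it (k0-s3-w1's `abs3A'_of_W1LettersAt`, p611287) restore uniformity with the windowed NE9 letter + fading-memory
moduli — i.e. with the DIFFERENCED `YoungLipschitz` slot of the towers, which is NOT PRINTED for d = 4 (dag-n22's honest framing).  But the N22 value engine
`YMDAG.N22.WindowSoftTwoPoint.windowedDecay_localizedSum_of_activitySlots` (p60xxxx, `…AtSlots`) already proves its eventual bound with ONE constant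
`C_unif = (16·e·9·64·K₀(64,8)²·A·B₃²∕r²)·e^{12Mδ₁}·K₀(4·2⁴,8)·K₁(4,δ₀∕2)` for EVERY `g ∈ W` (its own docstring), from the VALUE slot `Bound238` alone (+ activity holomorphy
through the complexified probe readings + the minimiser tails of the site weights + Road 1's numerals) — it merely hides the constant under W1's `∃ C₀`.  THIS FILE keeps it
outside: §1 the engine's value bound with `C_unif` displayed (generic reading `localizedSum F S emb`; proof = the engine's own two junctions `abs_polWindow_localizedSum_le_soft_of_activitySlots`
(J30 v1.1) and `valueSummand_le_softMajorant` fed to `eventually_le_of_softSum_domSys`); §2 under W1-20's law `Localizes17OfRecord₁₃ F N θ S emb` this IS FILE 2's UNIFORM box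
currency on `]0, θ.γ]` for the merged term of record (`extd`∕`histPrefix_extd`, `Localizes17.eventuallyAgree`, `polWindow_hist_eventuallyEq_of_eventuallyAgree`); §3 with W1's
`PolLimitsExistOfRecord₁₃ F N θ` ⟹ the sign-free box `BetaLowerH (−β′₅₁₀(4; C_unif, δ₁)) θ.γ β₁₃(θ) ∧ BetaUpperH … θ.γ …` (FILE 2 `absBox_betaOfRecord₁₃_of_uniformEventualDecayOnBox`),
`δ₁ = ½min{δ₀, κ(4M)⁻¹}` (`0 < κ` displayed); §2b (k0-s3-w1 g0's pointer I.≈31280): the (1.21) letter is itself dag-n22-w3's ★ `polLimitsExistOfRecord₁₃_of_activitySlots`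
(`…N22KernelLimitOfActivitySlots`, p60xxxx) from the SAME value-slot data plus ONE displayed law (S≈) «approximate cross-volume stability» (`lo`, `0 ≤ r₀ < 1`, `hS`) and Road 1's
`κ₀ ≤ κ∕4` — so ★★★ `absBox_betaOfRecord₁₃_of_activitySlots_of_approxStable` puts the K0 box on N22's ACTIVITY-LEVEL letters + laws ALONE (no kernel-level letter left:
(1.21), NE9, (D4), fading memory all paid by name); §4 at V19's socket: a half-window box at the collared witness for every admissible letter ⟹ `K0V19Defs.AbsBetaBoxAtThm1WitnessCCMGenAt F`
(γ₀ := ½ = θ.γ), so §3 at `θ₁₅ᶜᶜᴹ(j; ε₀, ε₂₉; …)` is a supplier of the socket; K0⁷ BY NAME from stub 1's text + such boxes.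

SO THE K0 β-BOX BILL, IN N22's ACTIVITY CURRENCY, IS: towers ∕ reading with `Localizes17OfRecord₁₃` (the cluster expansion's (1.7) law — NODE A ∕ N10), `Bound238` at every tower and
level on prefix sets containing the window's cut histories ((1.18)-type VALUE bounds — N10 ∕ NODE A), holomorphic activities through complexified probe readings of the record's
β-chart on balls of radius `r` and site-weight tails `B₃e^{−δ₀ distCT}` ([I] p.264 «can be extended to an analytic function», p.282 ∕ [15] §G — NODE A ∕ N09), Road 1's numerals,
`0 < κ`, and `PolLimitsExistOfRecord₁₃` ((1.21)) — and NOT the differenced slot ∕ NE9 ∕ fading memory.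

HONEST FRAMING.  By-name composition of landed N22 ∕ W1 ∕ K0 theorems + real bookkeeping; every engine input above is a HYPOTHESIS (displayed, inhabited nowhere in the tree);
NO estimate of Bałaban's proved or asserted; stub 3ᴬ′ NOT proved ([I] §1 p.264 «uniformly bounded» STATED, proof unpublished [Balaban1989LargeFieldII] p.355); stub 1 untouched;
K0⁷ stmt-QuantumFields-20541 OPEN (V19 87879403b3a26109 stands); N22 ∕ K3⁷ untouched and NOT claimed; counts unmoved (typed 28∕28 · discharged 5∕28 — the chair's words).  One finite
𝕋⁴ programme at fixed `ε = L^{−K}`, Bałaban AS PRINTED — NOT continuum ∕ ℝ⁴ ∕ OS ∕ mass gap ∕ Clay: the Yang–Mills mass gap is NOT proved by any of this; route R4 closes the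
CONDITIONAL finite-𝕋⁴ rung `BalabanLadder.UV` only.  No `sorry`, `def`, `instance`, `notation`, `axiom`.
-/

noncomputable section

open Filter Topology Metric Set
open scoped BigOperators Matrix.Norms.L2Operator

namespace Summit.QuantumFields.YangMills.Theorems.K0Stub3FinVolFaceOfActivitySlots

open Literature.MathematicalPhysics.QuantumFieldTheory.Balaban1983to89
open Literature.MathematicalPhysics.QuantumFieldTheory.Balaban1983to89.T4Continuum (T4Family)
open Literature.MathematicalPhysics.QuantumFieldTheory.Balaban1983to89.T4OutputRate (Window)
open Literature.MathematicalPhysics.QuantumFieldTheory.Balaban1983to89.T4FlagMemory (extd)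
open Literature.MathematicalPhysics.QuantumFieldTheory.Balaban1983to89.T4BetaReadOut (extd_mem_window)
open Literature.MathematicalPhysics.QuantumFieldTheory.Balaban1983to89.FlowStep (Box BetaLowerH BetaUpperH)
open Literature.MathematicalPhysics.QuantumFieldTheory.Balaban1983to89.Node00 (TermFamily1 polWindow polScalar siteOfInt Stage13Params MatA mergedTermFamilyMatT TβOfRecord₁₃ chiβOfRecord₁₃
  betaOfRecord₁₃ theta13OfThm1CCM theta13OfThm1CCM_γ VariationalThm1RegSepCoP7M Gauge9RegSepTopStepR suppDomOfRecord)
open Literature.MathematicalPhysics.QuantumFieldTheory.Balaban1983to89.Node00.Sect2 (domCount domSys CPair)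
open Literature.MathematicalPhysics.QuantumFieldTheory.Balaban1983to89.Node00.LocalizedSum17 (localizedSum ReadingMaps Localizes17OfRecord₁₃)
open Literature.MathematicalPhysics.QuantumFieldTheory.Balaban1983to89.Node00.W1 (ClusterTower)
open Literature.MathematicalPhysics.QuantumFieldTheory.Balaban1983to89.Node00.U3OfKernels (histPrefix histPrefix_extd)
open Literature.MathematicalPhysics.QuantumFieldTheory.Balaban1983to89.Node00.U3KernelLetters (PolLimitsExistOfRecord₁₃ polWindow_hist_eventuallyEq_of_eventuallyAgree)
open Literature.MathematicalPhysics.QuantumFieldTheory.Balaban1983to89.B12Decay510 (delta1 delta1_pos)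
open Literature.MathematicalPhysics.QuantumFieldTheory.Balaban1983to89.B12Decay510Window (K₁)
open Literature.MathematicalPhysics.QuantumFieldTheory.Balaban1983to89.B12Decay510Torus (distCT nearT)
open Literature.MathematicalPhysics.QuantumFieldTheory.Balaban1983to89.B12TreeDecay (K₀ kappa₀ K₀_pos)
open Literature.MathematicalPhysics.QuantumFieldTheory.Balaban1983to89.TreeLengthTorus (TPt torusTreeLen torusTreeLen_nonneg)
open Literature.MathematicalPhysics.QuantumFieldTheory.Balaban1983to89.B12Sec2to5 (l1 betaPrime510)
open YMDAG.N22.WindowOfLocalTerms (abs_polWindow_localizedSum_le_soft_of_activitySlots)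
open YMDAG.N22.WindowSoftTwoPoint (eventually_le_of_softSum_domSys valueSummand_le_softMajorant)
open YMDAG.N22.AtKernels (polLimitsExistOfRecord₁₃_of_activitySlots)
open Summit.QuantumFields.YangMills.Theorems.K0V19Defs (Prop8StepCoPAt AbsBetaBoxAtThm1WitnessCCMGenAt)
open Summit.QuantumFields.YangMills.Theorems.K0V19Stub2Prime (record13SepCoPHInhabited_of_stub1_stub3A'_byName)
open Summit.QuantumFields.YangMills.Theorems.K0Stub3FinVolPeriodicity (box_mono_of_le)
open Summit.QuantumFields.YangMills.Theorems.K0Stub3FinVolFace (absBox_betaOfRecord₁₃_of_uniformEventualDecayOnBox polLimitsExistBox_of_record)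

/-! ## §1  The engine's VALUE bound with its history-UNIFORM constant displayed (generic W1 reading `localizedSum F S emb`) -/

section Generic

variable (F : T4Family)
variable {𝔸 : Type*} [NormedRing 𝔸] [NormedAlgebra ℝ 𝔸] {V : Type*} [NormedAddCommGroup V] [NormedSpace ℝ V] {ι' : Type*} [Fintype ι']

open Classical in
/-- **★ THE SOFT ROAD AT ACTIVITY LEVEL, VALUE LETTER, WITH THE UNIFORM CONSTANT OUTSIDE THE `∃`.**  Hypotheses VERBATIM those of dag-n22-w2's
`windowedDecay_localizedSum_of_activitySlots` (towers `S K`, reading maps `emb`, chart `ρ ∕ bV`, window `W`, prefix sets `Wk`, spaces `sp`, `Bound238` with Road 1's numerals,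
complexified probe readings `Φ K k X` on open `U K k X ⊇ ball 0 r` extending `emb ∘ exp ρ` with holomorphic activities, site weights `w` with tails `B₃e^{−δ₀ distCT}`); conclusion:
for EVERY `g ∈ W`, every level `k` and separation `z`, eventually in `K`, `|Π_K(histPrefix g k; z)| ≤ C_unif · e^{−δ₁|z|₁}` with `δ₁ = ½min{δ₀, κ(4M)⁻¹}` and the ONE constant
`C_unif = (16·e·9·64·K₀(64,8)²·A·B₃²∕r²)·e^{12Mδ₁}·K₀(4·2⁴,8)·K₁(4,δ₀∕2)·1` — the engine's own constant, g-INDEPENDENT.  Proof = the engine's (J30 v1.1 value bound + the value junction fed to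
`eventually_le_of_softSum_domSys`).  CONDITIONAL; nothing asserted. -/
theorem uniformWindowedDecay_localizedSum_of_activitySlots (m' : ℕ) (M : ℕ) [NeZero M] (hM : M = F.L ^ m')
    (S : (K : ℕ) → ClusterTower (F.P K) 𝔸 M) (emb : ReadingMaps F 𝔸 𝔸) (ρ : V →L[ℝ] 𝔸) (bV : Module.Basis ι' ℝ V) (W : Set (ℕ → ℝ))
    (Wk : (K k : ℕ) → Set (Fin (k + 1) → ℝ)) (hWk : ∀ g ∈ W, ∀ K k, histPrefix g k ∈ Wk K k)
    (sp : (K k : ℕ) → (domSys (F.P K) M (k + 1)).Dom → Set (CPair (F.P K) 𝔸))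
    {A R r₁ κ δ₀ B₃ r : ℝ}
    (hA : 0 ≤ A) (hr₁ : 0 ≤ r₁) (hκ : κ ≤ r₁) (hκ₀ : kappa₀ (4 * 2 ^ 4) (2 * 4) ≤ κ / 2) (hrate : r₁ + 2 * (64 * Real.log 162) + 2 ≤ R)
    (hsmall : A * Real.exp (5 * r₁ + 1) * K₀ 64 8 * 9 * 64 ≤ 1) (hδ₀ : 0 < δ₀) (hB₃ : 0 ≤ B₃) (hr : 0 < r)
    (h238 : ∀ K k, ((S K) k).Bound238 (Wk K k) (sp K k) A R)
    (Ec : ℕ → ℕ → Type*) [∀ K k, NormedAddCommGroup (Ec K k)] [∀ K k, NormedSpace ℂ (Ec K k)]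
    (ι : (K k : ℕ) → (domSys (F.P K) M (k + 1)).Dom → ((Fin (F.P K).d → Site (F.P K) (k + 1) → V) →L[ℝ] Ec K k))
    (Φ : (K k : ℕ) → (domSys (F.P K) M (k + 1)).Dom → Ec K k → CPair (F.P K) 𝔸)
    (U : (K k : ℕ) → (domSys (F.P K) M (k + 1)).Dom → Set (Ec K k)) (hU : ∀ K k X, IsOpen (U K k X)) (hrU : ∀ K k X, ball (0 : Ec K k) r ⊆ U K k X)
    (hHhol : ∀ g ∈ W, ∀ (K k : ℕ) (X Z : (domSys (F.P K) M (k + 1)).Dom), Z.1 ⊆ X.1 →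
      DifferentiableOn ℂ (fun z => ((S K) k).H (histPrefix g k) (Φ K k X z) Z) (U K k X))
    (hΦemb : ∀ (K k : ℕ) (X : (domSys (F.P K) M (k + 1)).Dom) (B : Fin (F.P K).d → Site (F.P K) (k + 1) → V),
      Φ K k X (ι K k X B) = emb K k (fun l t => NormedSpace.exp (ρ (B l t))))
    (hΦsp : ∀ (K k : ℕ) (X : (domSys (F.P K) M (k + 1)).Dom), ∀ z ∈ U K k X, ∀ Z : (domSys (F.P K) M (k + 1)).Dom, Z.1 ⊆ X.1 → Φ K k X z ∈ sp K k Z)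
    (w : (K k : ℕ) → (domSys (F.P K) M (k + 1)).Dom → Site (F.P K) (k + 1) → ℝ) (hw₀ : ∀ K k X t, 0 ≤ w K k X t)
    (hw : ∀ (K k : ℕ) (X : (domSys (F.P K) M (k + 1)).Dom) (l : Fin (F.P K).d) (t : Site (F.P K) (k + 1)) (c : ι'),
      ‖ι K k X (Pi.single l (Pi.single t (bV c)))‖ ≤ w K k X t)
    (htail : ∀ (K k : ℕ) (X : (domSys (F.P K) M (k + 1)).Dom) (t : Site (F.P K) (k + 1)),
      let e : Site (F.P K) (k + 1) → TPt 4 (domCount (F.P K) M (k + 1) * M) := fun x i => (ZMod.cast (x i) : ZMod (domCount (F.P K) M (k + 1) * M))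
      w K k X t ≤ B₃ * Real.exp (-δ₀ * distCT (domCount (F.P K) M (k + 1)) M (e t) (nearT (M := M) (e t) X)))
    (μ ν : Fin 4) :
    ∀ g ∈ W, ∀ (k : ℕ) (z : Fin 4 → ℤ), ∀ᶠ K in atTop,
      |polWindow F K (k + 1) (localizedSum F S emb k (histPrefix g k) K) ρ bV μ ν z| ≤
        (16 * (Real.exp 1 * 9 * 64 * K₀ 64 8 ^ 2) * A * B₃ ^ 2 / r ^ 2 *
        Real.exp (delta1 δ₀ κ ((M : ℝ) * 4) * ((M : ℝ) * 4) * 3) * K₀ (4 * 2 ^ 4) (2 * 4) * K₁ 4 (δ₀ / 2) * 1) *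
          Real.exp (-(delta1 δ₀ κ ((M : ℝ) * 4)) * l1 z) := by
  intro g hg k z
  have hc : (0 : ℝ) ≤ Real.exp 1 * 9 * 64 * K₀ 64 8 ^ 2 := by have := K₀_pos 64 8; positivity
  have hCE : (0 : ℝ) ≤ 16 * (Real.exp 1 * 9 * 64 * K₀ 64 8 ^ 2) * A * B₃ ^ 2 / r ^ 2 := by positivity
  have h := eventually_le_of_softSum_domSys F (k + 1) m' M hM
    (fun K => |polWindow F K (k + 1) (localizedSum F S emb k (histPrefix g k) K) ρ bV μ ν z|)
    (fun K X => 16 * (Real.exp 1 * 9 * 64 * K₀ 64 8 ^ 2 * A * Real.exp (-(r₁ * torusTreeLen X.1))) / r ^ 2 *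
      (w K k X (siteOfInt F K (k + 1) z) * w K k X (siteOfInt F K (k + 1) 0)))
    hCE zero_le_one hδ₀ hκ₀ z (fun K => ?_) (fun K X => ?_)
  · filter_upwards [h] with K hK
    rw [neg_mul]
    exact hK
  · exact abs_polWindow_localizedSum_le_soft_of_activitySlots F S emb ρ bV k K (Wk K k) (sp K k) hA hr₁ hrate hsmall (h238 K k) (hWk g hg K k)
      (ι K k) (Φ K k) (U K k) (hU K k) hr (hrU K k) (hHhol g hg K k) (hΦemb K k) (hΦsp K k) (w K k) (hw₀ K k) (hw K k) μ ν z
  · exact valueSummand_le_softMajorant hc hA hr hB₃ (hw₀ K k X _) (Real.exp_nonneg _) (Real.exp_nonneg _) (htail K k X _) (htail K k X _) hκ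
      (torusTreeLen_nonneg _)

/-- **BOX FORM of §1**: at every box history `v ∈ ]0, γ]^{k+1}` with `Window γ ⊆ W` (via `extd v`), the same uniform eventual bound for `localizedSum F S emb k v K`. -/
theorem uniformWindowedDecay_localizedSum_box_of_activitySlots (m' : ℕ) (M : ℕ) [NeZero M] (hM : M = F.L ^ m')
    (S : (K : ℕ) → ClusterTower (F.P K) 𝔸 M) (emb : ReadingMaps F 𝔸 𝔸) (ρ : V →L[ℝ] 𝔸) (bV : Module.Basis ι' ℝ V) (W : Set (ℕ → ℝ))
    (Wk : (K k : ℕ) → Set (Fin (k + 1) → ℝ)) (hWk : ∀ g ∈ W, ∀ K k, histPrefix g k ∈ Wk K k)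
    (sp : (K k : ℕ) → (domSys (F.P K) M (k + 1)).Dom → Set (CPair (F.P K) 𝔸))
    {A R r₁ κ δ₀ B₃ r : ℝ}
    (hA : 0 ≤ A) (hr₁ : 0 ≤ r₁) (hκ : κ ≤ r₁) (hκ₀ : kappa₀ (4 * 2 ^ 4) (2 * 4) ≤ κ / 2) (hrate : r₁ + 2 * (64 * Real.log 162) + 2 ≤ R)
    (hsmall : A * Real.exp (5 * r₁ + 1) * K₀ 64 8 * 9 * 64 ≤ 1) (hδ₀ : 0 < δ₀) (hB₃ : 0 ≤ B₃) (hr : 0 < r)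
    (h238 : ∀ K k, ((S K) k).Bound238 (Wk K k) (sp K k) A R)
    (Ec : ℕ → ℕ → Type*) [∀ K k, NormedAddCommGroup (Ec K k)] [∀ K k, NormedSpace ℂ (Ec K k)]
    (ι : (K k : ℕ) → (domSys (F.P K) M (k + 1)).Dom → ((Fin (F.P K).d → Site (F.P K) (k + 1) → V) →L[ℝ] Ec K k))
    (Φ : (K k : ℕ) → (domSys (F.P K) M (k + 1)).Dom → Ec K k → CPair (F.P K) 𝔸)
    (U : (K k : ℕ) → (domSys (F.P K) M (k + 1)).Dom → Set (Ec K k)) (hU : ∀ K k X, IsOpen (U K k X)) (hrU : ∀ K k X, ball (0 : Ec K k) r ⊆ U K k X)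
    (hHhol : ∀ g ∈ W, ∀ (K k : ℕ) (X Z : (domSys (F.P K) M (k + 1)).Dom), Z.1 ⊆ X.1 →
      DifferentiableOn ℂ (fun z => ((S K) k).H (histPrefix g k) (Φ K k X z) Z) (U K k X))
    (hΦemb : ∀ (K k : ℕ) (X : (domSys (F.P K) M (k + 1)).Dom) (B : Fin (F.P K).d → Site (F.P K) (k + 1) → V),
      Φ K k X (ι K k X B) = emb K k (fun l t => NormedSpace.exp (ρ (B l t))))
    (hΦsp : ∀ (K k : ℕ) (X : (domSys (F.P K) M (k + 1)).Dom), ∀ z ∈ U K k X, ∀ Z : (domSys (F.P K) M (k + 1)).Dom, Z.1 ⊆ X.1 → Φ K k X z ∈ sp K k Z)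
    (w : (K k : ℕ) → (domSys (F.P K) M (k + 1)).Dom → Site (F.P K) (k + 1) → ℝ) (hw₀ : ∀ K k X t, 0 ≤ w K k X t)
    (hw : ∀ (K k : ℕ) (X : (domSys (F.P K) M (k + 1)).Dom) (l : Fin (F.P K).d) (t : Site (F.P K) (k + 1)) (c : ι'),
      ‖ι K k X (Pi.single l (Pi.single t (bV c)))‖ ≤ w K k X t)
    (htail : ∀ (K k : ℕ) (X : (domSys (F.P K) M (k + 1)).Dom) (t : Site (F.P K) (k + 1)),
      let e : Site (F.P K) (k + 1) → TPt 4 (domCount (F.P K) M (k + 1) * M) := fun x i => (ZMod.cast (x i) : ZMod (domCount (F.P K) M (k + 1) * M))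
      w K k X t ≤ B₃ * Real.exp (-δ₀ * distCT (domCount (F.P K) M (k + 1)) M (e t) (nearT (M := M) (e t) X)))
    (μ ν : Fin 4) {γ : ℝ} (hW : Window γ ⊆ W) :
    ∀ (k : ℕ) (v : Fin (k + 1) → ℝ), v ∈ Box γ k → ∀ z : Fin 4 → ℤ, ∀ᶠ K in atTop,
      |polWindow F K (k + 1) (localizedSum F S emb k v K) ρ bV μ ν z| ≤
        (16 * (Real.exp 1 * 9 * 64 * K₀ 64 8 ^ 2) * A * B₃ ^ 2 / r ^ 2 *
        Real.exp (delta1 δ₀ κ ((M : ℝ) * 4) * ((M : ℝ) * 4) * 3) * K₀ (4 * 2 ^ 4) (2 * 4) * K₁ 4 (δ₀ / 2) * 1) *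
          Real.exp (-(delta1 δ₀ κ ((M : ℝ) * 4)) * l1 z) := by
  intro k v hv z
  have h := uniformWindowedDecay_localizedSum_of_activitySlots F m' M hM S emb ρ bV W Wk hWk sp hA hr₁ hκ hκ₀ hrate hsmall hδ₀ hB₃ hr h238 Ec ι Φ U hU hrU
    hHhol hΦemb hΦsp w hw₀ hw htail μ ν (extd v) (hW (extd_mem_window hv)) k z
  simpa only [histPrefix_extd] using h

end Generic

/-! ## §2  AT THE RECORD: FILE 2's UNIFORM box currency on `]0, θ.γ]` for the merged term of record, from the engine's VALUE inputs under `Localizes17OfRecord₁₃` -/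

section Record

variable (F : T4Family) (N : ℕ) [NeZero N]

open Classical in
/-- **★★ THE UNIFORM BOX CURRENCY OF RECORD FROM ACTIVITY-LEVEL VALUE SLOTS.**  Towers `S K : ClusterTower (F.P K) (MatA N) M` and reading maps `emb` with W1-20's law at the record
`Localizes17OfRecord₁₃ F N θ S emb`; the VALUE-half hypotheses of the engine at the record's β-chart (`θ.ρ8`, `θ.bV`) on the window `]0, θ.γ]^ℕ` ⟹ FILE 2's currency: for every
level `k`, box history `v ∈ ]0, θ.γ]^{k+1}` and separation `z`, eventually in `K`, `|Π_K(v; z)| ≤ C_unif·e^{−δ₁|z|₁}` for the merged term family of record (transfer along the law: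
the record's and the reading's windowed kernels eventually AGREE).  CONDITIONAL; nothing asserted. -/
theorem uniformEventualDecayOnBox_of_activitySlotsAtRecord (θ : Stage13Params F N) (m' : ℕ) (M : ℕ) [NeZero M] (hM : M = F.L ^ m')
    (S : (K : ℕ) → ClusterTower (F.P K) (MatA N) M) (emb : ReadingMaps F (MatA N) (MatA N)) (hloc : Localizes17OfRecord₁₃ F N θ S emb)
    (Wk : (K k : ℕ) → Set (Fin (k + 1) → ℝ)) (hWk : ∀ g ∈ Window θ.γ, ∀ K k, histPrefix g k ∈ Wk K k)
    (sp : (K k : ℕ) → (domSys (F.P K) M (k + 1)).Dom → Set (CPair (F.P K) (MatA N)))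
    {A R r₁ κ δ₀ B₃ r : ℝ}
    (hA : 0 ≤ A) (hr₁ : 0 ≤ r₁) (hκ : κ ≤ r₁) (hκ₀ : kappa₀ (4 * 2 ^ 4) (2 * 4) ≤ κ / 2) (hrate : r₁ + 2 * (64 * Real.log 162) + 2 ≤ R)
    (hsmall : A * Real.exp (5 * r₁ + 1) * K₀ 64 8 * 9 * 64 ≤ 1) (hδ₀ : 0 < δ₀) (hB₃ : 0 ≤ B₃) (hr : 0 < r)
    (h238 : ∀ K k, ((S K) k).Bound238 (Wk K k) (sp K k) A R)
    (Ec : ℕ → ℕ → Type*) [∀ K k, NormedAddCommGroup (Ec K k)] [∀ K k, NormedSpace ℂ (Ec K k)]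
    (ι : letI := θ.instVβ₁; letI := θ.instVβ₂
      (K k : ℕ) → (domSys (F.P K) M (k + 1)).Dom → ((Fin (F.P K).d → Site (F.P K) (k + 1) → θ.Vβ) →L[ℝ] Ec K k))
    (Φ : (K k : ℕ) → (domSys (F.P K) M (k + 1)).Dom → Ec K k → CPair (F.P K) (MatA N))
    (U : (K k : ℕ) → (domSys (F.P K) M (k + 1)).Dom → Set (Ec K k)) (hU : ∀ K k X, IsOpen (U K k X)) (hrU : ∀ K k X, ball (0 : Ec K k) r ⊆ U K k X)
    (hHhol : ∀ g ∈ Window θ.γ, ∀ (K k : ℕ) (X Z : (domSys (F.P K) M (k + 1)).Dom), Z.1 ⊆ X.1 →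
      DifferentiableOn ℂ (fun z => ((S K) k).H (histPrefix g k) (Φ K k X z) Z) (U K k X))
    (hΦemb : letI := θ.instVβ₁; letI := θ.instVβ₂
      ∀ (K k : ℕ) (X : (domSys (F.P K) M (k + 1)).Dom) (B : Fin (F.P K).d → Site (F.P K) (k + 1) → θ.Vβ),
        Φ K k X (ι K k X B) = emb K k (fun l t => NormedSpace.exp (θ.ρ8 (B l t))))
    (hΦsp : ∀ (K k : ℕ) (X : (domSys (F.P K) M (k + 1)).Dom), ∀ z ∈ U K k X, ∀ Z : (domSys (F.P K) M (k + 1)).Dom, Z.1 ⊆ X.1 → Φ K k X z ∈ sp K k Z)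
    (w : (K k : ℕ) → (domSys (F.P K) M (k + 1)).Dom → Site (F.P K) (k + 1) → ℝ) (hw₀ : ∀ K k X t, 0 ≤ w K k X t)
    (hw : letI := θ.instVβ₁; letI := θ.instVβ₂; letI := θ.instιβ
      ∀ (K k : ℕ) (X : (domSys (F.P K) M (k + 1)).Dom) (l : Fin (F.P K).d) (t : Site (F.P K) (k + 1)) (c : θ.ιβ),
        ‖ι K k X (Pi.single l (Pi.single t (θ.bV c)))‖ ≤ w K k X t)
    (htail : ∀ (K k : ℕ) (X : (domSys (F.P K) M (k + 1)).Dom) (t : Site (F.P K) (k + 1)),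
      let e : Site (F.P K) (k + 1) → TPt 4 (domCount (F.P K) M (k + 1) * M) := fun x i => (ZMod.cast (x i) : ZMod (domCount (F.P K) M (k + 1) * M))
      w K k X t ≤ B₃ * Real.exp (-δ₀ * distCT (domCount (F.P K) M (k + 1)) M (e t) (nearT (M := M) (e t) X))) :
    letI := θ.instVβ₁; letI := θ.instVβ₂; letI := θ.instιβ
    ∀ (k : ℕ) (v : Fin (k + 1) → ℝ), v ∈ Box θ.γ k → ∀ z : Fin 4 → ℤ, ∀ᶠ K in atTop,
      |polWindow F K (k + 1) (mergedTermFamilyMatT F N (TβOfRecord₁₃ F N) (chiβOfRecord₁₃ F N θ) θ.εbg k v K) θ.ρ8 θ.bV 0 1 z| ≤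
        (16 * (Real.exp 1 * 9 * 64 * K₀ 64 8 ^ 2) * A * B₃ ^ 2 / r ^ 2 *
        Real.exp (delta1 δ₀ κ ((M : ℝ) * 4) * ((M : ℝ) * 4) * 3) * K₀ (4 * 2 ^ 4) (2 * 4) * K₁ 4 (δ₀ / 2) * 1) *
          Real.exp (-(delta1 δ₀ κ ((M : ℝ) * 4)) * l1 z) := by
  letI := θ.instVβ₁; letI := θ.instVβ₂; letI := θ.instιβ
  intro k v hv z
  have hbound := uniformWindowedDecay_localizedSum_box_of_activitySlots F m' M hM S emb θ.ρ8 θ.bV (Window θ.γ) Wk hWk sp hA hr₁ hκ hκ₀ hrate hsmall hδ₀ hB₃ hr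
    h238 Ec ι Φ U hU hrU hHhol hΦemb hΦsp w hw₀ hw htail 0 1 (subset_refl _) k v hv z
  have heq := polWindow_hist_eventuallyEq_of_eventuallyAgree F θ.ρ8 θ.bV (hloc.eventuallyAgree F) k v 0 1 z
  filter_upwards [hbound, heq] with K hK hKeq
  rw [hKeq]
  exact hK

open Classical in
/-- **★★ THE SIGN-FREE BOX OF `β₁₃(θ)` ON THE FULL DESIGN WINDOW FROM THE VALUE HALF OF THE ENGINE + (1.21)** — `β′ = β′₅₁₀(4; C_unif, δ₁)`, `δ₁ = ½min{δ₀, κ(4M)⁻¹}` (`0 < κ` and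
`0 < θ.γ`-free; FILE 2 `absBox_betaOfRecord₁₃_of_uniformEventualDecayOnBox` with W1's `PolLimitsExistOfRecord₁₃.box`).  NO YoungLipschitz slot, NO NE9, NO fading memory.  CONDITIONAL;
nothing asserted. -/
theorem absBox_betaOfRecord₁₃_of_activitySlots (θ : Stage13Params F N) (hlim : PolLimitsExistOfRecord₁₃ F N θ) (m' : ℕ) (M : ℕ) [NeZero M] (hM : M = F.L ^ m')
    (S : (K : ℕ) → ClusterTower (F.P K) (MatA N) M) (emb : ReadingMaps F (MatA N) (MatA N)) (hloc : Localizes17OfRecord₁₃ F N θ S emb)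
    (Wk : (K k : ℕ) → Set (Fin (k + 1) → ℝ)) (hWk : ∀ g ∈ Window θ.γ, ∀ K k, histPrefix g k ∈ Wk K k)
    (sp : (K k : ℕ) → (domSys (F.P K) M (k + 1)).Dom → Set (CPair (F.P K) (MatA N)))
    {A R r₁ κ δ₀ B₃ r : ℝ} (hκpos : 0 < κ)
    (hA : 0 ≤ A) (hr₁ : 0 ≤ r₁) (hκ : κ ≤ r₁) (hκ₀ : kappa₀ (4 * 2 ^ 4) (2 * 4) ≤ κ / 2) (hrate : r₁ + 2 * (64 * Real.log 162) + 2 ≤ R)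
    (hsmall : A * Real.exp (5 * r₁ + 1) * K₀ 64 8 * 9 * 64 ≤ 1) (hδ₀ : 0 < δ₀) (hB₃ : 0 ≤ B₃) (hr : 0 < r)
    (h238 : ∀ K k, ((S K) k).Bound238 (Wk K k) (sp K k) A R)
    (Ec : ℕ → ℕ → Type*) [∀ K k, NormedAddCommGroup (Ec K k)] [∀ K k, NormedSpace ℂ (Ec K k)]
    (ι : letI := θ.instVβ₁; letI := θ.instVβ₂
      (K k : ℕ) → (domSys (F.P K) M (k + 1)).Dom → ((Fin (F.P K).d → Site (F.P K) (k + 1) → θ.Vβ) →L[ℝ] Ec K k))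
    (Φ : (K k : ℕ) → (domSys (F.P K) M (k + 1)).Dom → Ec K k → CPair (F.P K) (MatA N))
    (U : (K k : ℕ) → (domSys (F.P K) M (k + 1)).Dom → Set (Ec K k)) (hU : ∀ K k X, IsOpen (U K k X)) (hrU : ∀ K k X, ball (0 : Ec K k) r ⊆ U K k X)
    (hHhol : ∀ g ∈ Window θ.γ, ∀ (K k : ℕ) (X Z : (domSys (F.P K) M (k + 1)).Dom), Z.1 ⊆ X.1 →
      DifferentiableOn ℂ (fun z => ((S K) k).H (histPrefix g k) (Φ K k X z) Z) (U K k X))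
    (hΦemb : letI := θ.instVβ₁; letI := θ.instVβ₂
      ∀ (K k : ℕ) (X : (domSys (F.P K) M (k + 1)).Dom) (B : Fin (F.P K).d → Site (F.P K) (k + 1) → θ.Vβ),
        Φ K k X (ι K k X B) = emb K k (fun l t => NormedSpace.exp (θ.ρ8 (B l t))))
    (hΦsp : ∀ (K k : ℕ) (X : (domSys (F.P K) M (k + 1)).Dom), ∀ z ∈ U K k X, ∀ Z : (domSys (F.P K) M (k + 1)).Dom, Z.1 ⊆ X.1 → Φ K k X z ∈ sp K k Z)
    (w : (K k : ℕ) → (domSys (F.P K) M (k + 1)).Dom → Site (F.P K) (k + 1) → ℝ) (hw₀ : ∀ K k X t, 0 ≤ w K k X t)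
    (hw : letI := θ.instVβ₁; letI := θ.instVβ₂; letI := θ.instιβ
      ∀ (K k : ℕ) (X : (domSys (F.P K) M (k + 1)).Dom) (l : Fin (F.P K).d) (t : Site (F.P K) (k + 1)) (c : θ.ιβ),
        ‖ι K k X (Pi.single l (Pi.single t (θ.bV c)))‖ ≤ w K k X t)
    (htail : ∀ (K k : ℕ) (X : (domSys (F.P K) M (k + 1)).Dom) (t : Site (F.P K) (k + 1)),
      let e : Site (F.P K) (k + 1) → TPt 4 (domCount (F.P K) M (k + 1) * M) := fun x i => (ZMod.cast (x i) : ZMod (domCount (F.P K) M (k + 1) * M))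
      w K k X t ≤ B₃ * Real.exp (-δ₀ * distCT (domCount (F.P K) M (k + 1)) M (e t) (nearT (M := M) (e t) X))) :
    BetaLowerH (-betaPrime510 4 ((16 * (Real.exp 1 * 9 * 64 * K₀ 64 8 ^ 2) * A * B₃ ^ 2 / r ^ 2 *
        Real.exp (delta1 δ₀ κ ((M : ℝ) * 4) * ((M : ℝ) * 4) * 3) * K₀ (4 * 2 ^ 4) (2 * 4) * K₁ 4 (δ₀ / 2) * 1)) (delta1 δ₀ κ ((M : ℝ) * 4))) θ.γ (betaOfRecord₁₃ F N θ) ∧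
      BetaUpperH (betaPrime510 4 ((16 * (Real.exp 1 * 9 * 64 * K₀ 64 8 ^ 2) * A * B₃ ^ 2 / r ^ 2 *
        Real.exp (delta1 δ₀ κ ((M : ℝ) * 4) * ((M : ℝ) * 4) * 3) * K₀ (4 * 2 ^ 4) (2 * 4) * K₁ 4 (δ₀ / 2) * 1)) (delta1 δ₀ κ ((M : ℝ) * 4))) θ.γ (betaOfRecord₁₃ F N θ) := by
  have hM4 : (0 : ℝ) < (M : ℝ) * 4 := by
    have : (0 : ℝ) < (M : ℝ) := Nat.cast_pos.2 (Nat.pos_of_neZero M)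
    positivity
  exact absBox_betaOfRecord₁₃_of_uniformEventualDecayOnBox F N θ le_rfl (delta1_pos hδ₀ hκpos hM4)
    (polLimitsExistBox_of_record F N θ le_rfl (hlim.box F N))
    (uniformEventualDecayOnBox_of_activitySlotsAtRecord F N θ m' M hM S emb hloc Wk hWk sp hA hr₁ hκ hκ₀ hrate hsmall hδ₀ hB₃ hr h238 Ec ι Φ U hU hrU
      hHhol hΦemb hΦsp w hw₀ hw htail)

open Classical in
/-- **★★★ THE K0 BOX ON N22's ACTIVITY-LEVEL LETTERS + LAWS ALONE** (k0-s3-w1 g0's pointer): the (1.21) letter `hlim` of `absBox_betaOfRecord₁₃_of_activitySlots` is dag-n22-w3's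
`polLimitsExistOfRecord₁₃_of_activitySlots` from the SAME towers ∕ reading ∕ value slot ∕ complexified readings ∕ tails, plus the displayed law (S≈) «approximate cross-volume stability of
the localized polarisation sums» (a locality cut `lo` with `hlo`, a ratio `0 ≤ r₀ < 1`, and `hS`), Road 1's sharper `κ₀(64,8) ≤ κ∕4`, and activity holomorphy on the prefix sets `Wk`
(which contain the window's cut histories).  ⊢ the sign-free box of `β₁₃(θ)` on `]0, θ.γ]` with `β′ = β′₅₁₀(4; C_unif, δ₁)`.  NO kernel-level letter remains ((1.21), NE9, (D4), fading
memory: all paid by name); NO YoungLipschitz slot.  CONDITIONAL on the activity-level hypotheses (displayed, inhabited nowhere); nothing of Bałaban asserted. -/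
theorem absBox_betaOfRecord₁₃_of_activitySlots_of_approxStable (θ : Stage13Params F N) (m' : ℕ) (M : ℕ) [NeZero M] (hM : M = F.L ^ m')
    (S : (K : ℕ) → ClusterTower (F.P K) (MatA N) M) (emb : ReadingMaps F (MatA N) (MatA N)) (hloc : Localizes17OfRecord₁₃ F N θ S emb)
    (Wk : (K k : ℕ) → Set (Fin (k + 1) → ℝ)) (hWk : ∀ g ∈ Window θ.γ, ∀ K k, histPrefix g k ∈ Wk K k)
    (sp : (K k : ℕ) → (domSys (F.P K) M (k + 1)).Dom → Set (CPair (F.P K) (MatA N)))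
    {A R r₁ κ δ₀ B₃ r r₀ : ℝ} (hκpos : 0 < κ)
    (hA : 0 ≤ A) (hr₁ : 0 ≤ r₁) (hκ : κ ≤ r₁) (hκ4 : kappa₀ (4 * 2 ^ 4) (2 * 4) ≤ κ / 2 / 2) (hrate : r₁ + 2 * (64 * Real.log 162) + 2 ≤ R)
    (hsmall : A * Real.exp (5 * r₁ + 1) * K₀ 64 8 * 9 * 64 ≤ 1) (hδ₀ : 0 < δ₀) (hB₃ : 0 ≤ B₃) (hr : 0 < r)
    (h238 : ∀ K k, ((S K) k).Bound238 (Wk K k) (sp K k) A R)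
    (Ec : ℕ → ℕ → Type*) [∀ K k, NormedAddCommGroup (Ec K k)] [∀ K k, NormedSpace ℂ (Ec K k)]
    (ι : letI := θ.instVβ₁; letI := θ.instVβ₂
      (K k : ℕ) → (domSys (F.P K) M (k + 1)).Dom → ((Fin (F.P K).d → Site (F.P K) (k + 1) → θ.Vβ) →L[ℝ] Ec K k))
    (Φ : (K k : ℕ) → (domSys (F.P K) M (k + 1)).Dom → Ec K k → CPair (F.P K) (MatA N))
    (U : (K k : ℕ) → (domSys (F.P K) M (k + 1)).Dom → Set (Ec K k)) (hU : ∀ K k X, IsOpen (U K k X)) (hrU : ∀ K k X, ball (0 : Ec K k) r ⊆ U K k X)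
    (hHhol : ∀ K k, ∀ hist ∈ Wk K k, ∀ (X Z : (domSys (F.P K) M (k + 1)).Dom), Z.1 ⊆ X.1 →
      DifferentiableOn ℂ (fun z => ((S K) k).H hist (Φ K k X z) Z) (U K k X))
    (hΦemb : letI := θ.instVβ₁; letI := θ.instVβ₂
      ∀ (K k : ℕ) (X : (domSys (F.P K) M (k + 1)).Dom) (B : Fin (F.P K).d → Site (F.P K) (k + 1) → θ.Vβ),
        Φ K k X (ι K k X B) = emb K k (fun l t => NormedSpace.exp (θ.ρ8 (B l t))))
    (hΦsp : ∀ (K k : ℕ) (X : (domSys (F.P K) M (k + 1)).Dom), ∀ z ∈ U K k X, ∀ Z : (domSys (F.P K) M (k + 1)).Dom, Z.1 ⊆ X.1 → Φ K k X z ∈ sp K k Z)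
    (w : (K k : ℕ) → (domSys (F.P K) M (k + 1)).Dom → Site (F.P K) (k + 1) → ℝ) (hw₀ : ∀ K k X t, 0 ≤ w K k X t)
    (hw : letI := θ.instVβ₁; letI := θ.instVβ₂; letI := θ.instιβ
      ∀ (K k : ℕ) (X : (domSys (F.P K) M (k + 1)).Dom) (l : Fin (F.P K).d) (t : Site (F.P K) (k + 1)) (c : θ.ιβ),
        ‖ι K k X (Pi.single l (Pi.single t (θ.bV c)))‖ ≤ w K k X t)
    (htail : ∀ (K k : ℕ) (X : (domSys (F.P K) M (k + 1)).Dom) (t : Site (F.P K) (k + 1)),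
      let e : Site (F.P K) (k + 1) → TPt 4 (domCount (F.P K) M (k + 1) * M) := fun x i => (ZMod.cast (x i) : ZMod (domCount (F.P K) M (k + 1) * M))
      w K k X t ≤ B₃ * Real.exp (-δ₀ * distCT (domCount (F.P K) M (k + 1)) M (e t) (nearT (M := M) (e t) X)))
    (lo : (k K : ℕ) → (domSys (F.P K) M (k + 1)).Dom → Prop) [∀ k K, DecidablePred (lo k K)]
    (hlo : ∀ (k K : ℕ) (X : (domSys (F.P K) M (k + 1)).Dom), ¬ lo k K X →
      let e : Site (F.P K) (k + 1) → TPt 4 (domCount (F.P K) M (k + 1) * M) := fun x i => (ZMod.cast (x i) : ZMod (domCount (F.P K) M (k + 1) * M))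
      (K : ℝ) ≤ torusTreeLen X.1 ∨ (K : ℝ) ≤ distCT (domCount (F.P K) M (k + 1)) M (e (siteOfInt F K (k + 1) 0)) (nearT (M := M) (e (siteOfInt F K (k + 1) 0)) X))
    (hr₀ : r₀ < 1) (hr₀' : 0 ≤ r₀)
    (hS : letI := θ.instVβ₁; letI := θ.instVβ₂; letI := θ.instιβ
      ∀ g ∈ Window θ.γ, ∀ (k : ℕ) (μ ν : Fin 4) (z : Fin 4 → ℤ), ∃ (K₀ : ℕ) (C : ℝ), ∀ K : ℕ, K₀ ≤ K →
      |∑ X ∈ Finset.univ.filter (lo k (K + 1)), polScalar (fun U' => (((S (K + 1)) k).E (histPrefix g k) (emb (K + 1) k U') X).re) θ.ρ8 θ.bV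
            (Fin.cast (F.P_d (K + 1)).symm μ) (siteOfInt F (K + 1) (k + 1) z) (Fin.cast (F.P_d (K + 1)).symm ν) (siteOfInt F (K + 1) (k + 1) 0) -
        ∑ X ∈ Finset.univ.filter (lo k K), polScalar (fun U' => (((S K) k).E (histPrefix g k) (emb K k U') X).re) θ.ρ8 θ.bV
            (Fin.cast (F.P_d K).symm μ) (siteOfInt F K (k + 1) z) (Fin.cast (F.P_d K).symm ν) (siteOfInt F K (k + 1) 0)| ≤ C * r₀ ^ K) :
    BetaLowerH (-betaPrime510 4 ((16 * (Real.exp 1 * 9 * 64 * K₀ 64 8 ^ 2) * A * B₃ ^ 2 / r ^ 2 *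
        Real.exp (delta1 δ₀ κ ((M : ℝ) * 4) * ((M : ℝ) * 4) * 3) * K₀ (4 * 2 ^ 4) (2 * 4) * K₁ 4 (δ₀ / 2) * 1)) (delta1 δ₀ κ ((M : ℝ) * 4))) θ.γ (betaOfRecord₁₃ F N θ) ∧
      BetaUpperH (betaPrime510 4 ((16 * (Real.exp 1 * 9 * 64 * K₀ 64 8 ^ 2) * A * B₃ ^ 2 / r ^ 2 *
        Real.exp (delta1 δ₀ κ ((M : ℝ) * 4) * ((M : ℝ) * 4) * 3) * K₀ (4 * 2 ^ 4) (2 * 4) * K₁ 4 (δ₀ / 2) * 1)) (delta1 δ₀ κ ((M : ℝ) * 4))) θ.γ (betaOfRecord₁₃ F N θ) := by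
  -- Road 1's sharper numeral gives the engine's `κ₀ ≤ κ∕2`; holomorphy on the prefix sets gives it at the window's cut histories
  have hκ₀ : kappa₀ (4 * 2 ^ 4) (2 * 4) ≤ κ / 2 := hκ4.trans (by linarith)
  have hHholW : ∀ g ∈ Window θ.γ, ∀ (K k : ℕ) (X Z : (domSys (F.P K) M (k + 1)).Dom), Z.1 ⊆ X.1 →
      DifferentiableOn ℂ (fun z => ((S K) k).H (histPrefix g k) (Φ K k X z) Z) (U K k X) :=
    fun g hg K k X Z hZX => hHhol K k (histPrefix g k) (hWk g hg K k) X Z hZX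
  have hlim : PolLimitsExistOfRecord₁₃ F N θ :=
    polLimitsExistOfRecord₁₃_of_activitySlots F N θ m' hM S emb hloc Wk hWk sp hA hr₁ hκpos hκ hκ4 hrate hsmall hB₃ hδ₀ hr h238
      Ec ι Φ U hU hrU hHhol hΦemb hΦsp w hw₀ hw htail lo hlo hr₀ hr₀' hS
  exact absBox_betaOfRecord₁₃_of_activitySlots F N θ hlim m' M hM S emb hloc Wk hWk sp hκpos hA hr₁ hκ hκ₀ hrate hsmall hδ₀ hB₃ hr h238 Ec ι Φ U hU hrU
    hHholW hΦemb hΦsp w hw₀ hw htail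

end Record

/-! ## §3  AT V19's SOCKET: half-window boxes at the collared witness ⟹ 3ᴬ′ BY NAME — so §2 at `θ₁₅ᶜᶜᴹ(j; ε₀, ε₂₉; …)` (`θ.γ = ½`) is a supplier; K0⁷ BY NAME -/

section AtWitness

/-- **A HALF-WINDOW BOX AT THE COLLARED WITNESS FOR EVERY ADMISSIBLE LETTER PAYS THE SOCKET** (`γ₀ := ½`): the shape §2 delivers at `θ = theta13OfThm1CCM F 2 j ε₀ ε₂₉ B₃ B₃' a₀ a₁`
(design box `γ = ½`) for SOME `ε₀, ε₂₉ > 0`, at every cube letter and constants where the guards and the tokens (8)∕(9) hold, gives `K0V19Defs.AbsBetaBoxAtThm1WitnessCCMGenAt F`.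
[cite: Balaban1987RG1, Thm 1 p.259, §1 p.264; Balaban1985Variational, Thm 1 (8)–(9) p.279; Balaban1988Convergent, Thm 1 p.262] -/
theorem abs3A'_of_halfBoxAt (F : T4Family)
    (h : ∀ (j c : ℕ) (B₃ B₃' a₀ a₁ : ℝ), c ≤ F.L ^ j → 2 * (F.L : ℝ) ^ 2 ≤ B₃ → 0 < B₃' → 0 < a₀ → 0 < a₁ →
      VariationalThm1RegSepCoP7M F 2 B₃ a₀ a₁ →
      Gauge9RegSepTopStepR F 2 (fun ν K Ω => suppDomOfRecord F ν K Ω) (F.L ^ j) c B₃ B₃' a₀ a₁ →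
      ∃ ε₀ ε₂₉ β' : ℝ, 0 < ε₀ ∧ 0 < ε₂₉ ∧
        BetaLowerH (-β') (theta13OfThm1CCM F 2 j ε₀ ε₂₉ B₃ B₃' a₀ a₁).γ (betaOfRecord₁₃ F 2 (theta13OfThm1CCM F 2 j ε₀ ε₂₉ B₃ B₃' a₀ a₁)) ∧
        BetaUpperH β' (theta13OfThm1CCM F 2 j ε₀ ε₂₉ B₃ B₃' a₀ a₁).γ (betaOfRecord₁₃ F 2 (theta13OfThm1CCM F 2 j ε₀ ε₂₉ B₃ B₃' a₀ a₁))) :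
    AbsBetaBoxAtThm1WitnessCCMGenAt F := by
  intro j c B₃ B₃' a₀ a₁ hc hB hB' ha₀ ha₁ h15 h9
  obtain ⟨ε₀, ε₂₉, β', hε₀, hε₂₉, hlow, hup⟩ := h j c B₃ B₃' a₀ a₁ hc hB hB' ha₀ ha₁ h15 h9
  rw [theta13OfThm1CCM_γ] at hlow hup
  exact ⟨1 / 2, ε₀, ε₂₉, β', by norm_num, hε₀, hε₂₉, hlow, hup⟩

/-- **K0⁷ BY NAME FROM STUB 1's TEXT AND HALF-WINDOW BOXES AT THE WITNESS** (stub 2′ by name inside `K0V19Stub2Prime`, p595104); with §2 as the supplier of the boxes this is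
«K0⁷ from stub 1 + the VALUE half of N22's activity-slot engine + (1.21) at the witness».  CONDITIONAL; K0⁷ NOT closed by this.
[cite: Balaban1985Variational, Thm 1 (8)–(9) p.279, Prop. 8 p.304; Balaban1985RegularSpaces, Prop. 6 p.99; Balaban1988Convergent, Thm 1 p.262; Balaban1987RG1, Thm 1 p.259, §1 p.264] -/
theorem record13SepCoPHInhabited_of_stub1_halfBoxAt_byName (h1 : ∀ F : T4Family, Prop8StepCoPAt F)
    (h : ∀ (F : T4Family) (j c : ℕ) (B₃ B₃' a₀ a₁ : ℝ), c ≤ F.L ^ j → 2 * (F.L : ℝ) ^ 2 ≤ B₃ → 0 < B₃' → 0 < a₀ → 0 < a₁ →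
      VariationalThm1RegSepCoP7M F 2 B₃ a₀ a₁ →
      Gauge9RegSepTopStepR F 2 (fun ν K Ω => suppDomOfRecord F ν K Ω) (F.L ^ j) c B₃ B₃' a₀ a₁ →
      ∃ ε₀ ε₂₉ β' : ℝ, 0 < ε₀ ∧ 0 < ε₂₉ ∧
        BetaLowerH (-β') (theta13OfThm1CCM F 2 j ε₀ ε₂₉ B₃ B₃' a₀ a₁).γ (betaOfRecord₁₃ F 2 (theta13OfThm1CCM F 2 j ε₀ ε₂₉ B₃ B₃' a₀ a₁)) ∧
        BetaUpperH β' (theta13OfThm1CCM F 2 j ε₀ ε₂₉ B₃ B₃' a₀ a₁).γ (betaOfRecord₁₃ F 2 (theta13OfThm1CCM F 2 j ε₀ ε₂₉ B₃ B₃' a₀ a₁))) :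
    Summit.QuantumFields.YangMills.Theses.BalabanUVNodes.Record13SepCoPHInhabited :=
  record13SepCoPHInhabited_of_stub1_stub3A'_byName h1 fun F => abs3A'_of_halfBoxAt F (h F)

end AtWitness

end Summit.QuantumFields.YangMills.Theorems.K0Stub3FinVolFaceOfActivitySlots

end
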